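import Summits.SmoothPoincare4.SmoothPoincare4.Theorems.ConvexBisectionAcyclicBisectionExistsDualHandlePushImage
import Summits.SmoothPoincare4.SmoothPoincare4.Theorems.ConvexBisectionAcyclicBisectionExistsDualHandleModelRegionDefs
import HarnessLib

/-!
# Dual handles, XIV: the model push `sh` of `X₁` lands exactly on `{H ≥ 0}` minus the circle `C`
(brick (PUSH-f) of the sub-goal T3b step (ii) "push the prefix sub-handlebody `X₁` off the cocore
neighbourhood `N` of the suffix handles" of stub `stub_steinRealisation` (NF6), line
`modp-braid-orbits` r11, crux `ConvexBisection.AcyclicBisectionExists`, item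
stmt-SmoothPoincare4-10508; wave 3, lead c5, worker Z3)

Reconciliation of the push (`…DualHandlePush*.lean`, worker Z3) with the cocore neighbourhood `N`
and its model function `H = modelH κ δ` (`…DualHandleModelRegionDefs.lean`, worker Z2):

* `ridge_eq_cocoreCurve` — the ridge `ϱ` of the push files IS Z2's `cocoreCurve` (same formula);
* `pushTarget_eq` — **`sh '' {x_λ ≠ 0, ‖x‖ ≤ 1} = {‖x‖ ≤ 1, 0 ≤ H x} ∖ C`**,
  `C = {x_μ = 0, ‖x_λ‖² = pFun κ 0}`: the pushed `X₁ ∖ γ` is the superlevel set `{H ≥ 0}` of the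
  handle minus the circle `C` onto which the attaching circle `γ` itself is blown down
  (`…DualHandlePushTube.lean`); so `X₁' ∩ chart = {‖x‖ ≤ 1, H ≥ 0}` as T3b (iii) wants;
* `modelH_modelPush_seam` — the seam `{‖x‖ = 1, 0 < ‖x_λ‖² < 3κ²/4}` is pushed INTO the open ball
  onto the zero set `{H = 0}` (the new boundary `∂N ∩ {‖x‖ < 1}`);
* `helper_pushModel_modelH` (registered).

Everything here is proved; no named facts.

## References
* J. Milnor, *Lectures on the h-cobordism theorem* (1965), §3 (dual handles). [MilnorHCobordism1965]
* A. A. Kosinski, *Differential Manifolds* (1993), VI §6. [Kosinski1993]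
-/

noncomputable section

-- the prescribed namespace `Summit.<P>.<Sub>.…` duplicates `SmoothPoincare4` (P = Sub)
set_option linter.dupNamespace false

open scoped Manifold ContDiff Topology

namespace Summit.SmoothPoincare4.SmoothPoincare4.Theorems.AcyclicBisectionExists.ModpBraidOrbits

open Set Function Metric
open Literature.Topology.FourManifolds Literature.Topology.FourManifolds.HandleAttachingMap

namespace PushModel

section Region

variable {κ δ : ℝ}

/-- The ridge of the push files is Z2's `cocoreCurve` (identical formulas). [folklore] -/
theorem ridge_eq_cocoreCurve (κ δ P : ℝ) : ridge κ δ P = cocoreCurve κ δ P := rfl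

/-- `H` in the coordinates `P = sOf x`, `Q = muN x`. [folklore] -/
theorem modelH_eq (κ δ : ℝ) (x : EuclideanSpace ℝ (Fin 4)) : modelH κ δ x = modelHFun κ δ (sOf x) (muN x) := rfl

/-- **On the handle, `0 ≤ H ↔ (Q ≤ ϱ(P) ∧ (δ/4 ≤ Q ∨ pFun κ (Q/δ) ≤ P))`** — the zone-free
description of the superlevel set used by the push. [folklore] -/
theorem modelH_nonneg_iff (hκ : 0 < κ) (hκ2 : κ ≤ 1 / 2) (hδ : 0 < δ) (hδ2 : δ ≤ 1 / 2)
    {x : EuclideanSpace ℝ (Fin 4)} (hx : ‖x‖ ≤ 1) :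
    0 ≤ modelH κ δ x ↔ muN x ≤ ridge κ δ (sOf x) ∧ (δ / 4 ≤ muN x ∨ pFun κ (muN x / δ) ≤ sOf x) := by
  rw [norm_le_one_iff] at hx
  rw [modelH_eq, ridge_eq_cocoreCurve]
  set P := sOf x
  set Q := muN x
  have hQ0 : 0 ≤ Q := sq_nonneg _
  have hκsq : κ ^ 2 ≤ 1 / 4 := by nlinarith
  have hcle : cocoreCurve κ δ P ≤ 1 - P := cocoreCurve_le_one_sub hκ hκ2 hδ.le hδ2
  rcases le_or_gt Q (δ / 4) with hQ1 | hQ1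
  · -- swap slab `Q ≤ δ/4`: `H = P - pFun κ (Q/δ)`
    rw [modelHFun_of_le hδ hQ1, sub_nonneg]
    have key : pFun κ (Q / δ) ≤ P → Q ≤ cocoreCurve κ δ P := fun h => by
      have h1 : κ ^ 2 * (Q / δ) ≤ P := le_trans (sq_mul_le_pFun _) h
      have h2 : Q ≤ δ * P / κ ^ 2 := by
        rw [le_div_iff₀ (by positivity)]
        have h1' := mul_le_mul_of_nonneg_right h1 hδ.le
        rw [mul_assoc, div_mul_cancel₀ _ hδ.ne'] at h1'
        linarith
      exact le_trans (le_min (by linarith) h2) (min_le_cocoreCurve κ δ P)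
    constructor
    · intro h
      refine ⟨key h, ?_⟩
      rcases eq_or_lt_of_le hQ1 with hQe | hQl
      · left; exact hQe.ge
      · right; exact h
    · rintro ⟨hc, h | h⟩
      · -- `Q = δ/4`: `pFun κ (1/4) = κ²/4 ≤ P` from `δ/4 ≤ 𝒸(P)`
        have hQe : Q = δ / 4 := le_antisymm hQ1 h
        have hq : Q / δ = 1 / 4 := by rw [hQe]; field_simp
        rw [hq, pFun_of_ge κ le_rfl]
        by_contra hP
        have hP' : P < κ ^ 2 / 4 := by linarith [not_le.1 hP]
        rw [cocoreCurve_of_le hκ (by linarith [pow_pos hκ 2])] at hc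
        rw [hQe, le_div_iff₀ (by positivity)] at hc
        nlinarith
      · exact h
  · rcases le_or_gt (δ / 2) Q with hQ2 | hQ2
    · -- upper zone `Q ≥ δ/2`: `H = 𝒸(P) - Q`
      rw [modelHFun_of_ge hδ hQ2, sub_nonneg]
      exact ⟨fun h => ⟨h, Or.inl hQ1.le⟩, fun h => h.1⟩
    · -- line zone `δ/4 < Q < δ/2`
      rcases le_or_gt P (κ ^ 2 / 2) with hP | hP
      · rw [modelHFun_line hκ hδ hQ1.le hP, cocoreCurve_of_le hκ hP]
        have hm := lineMult_pos hκ hδ (Q / δ)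
        constructor
        · intro h
          exact ⟨by nlinarith [(mul_nonneg_iff_of_pos_left hm).1 h], Or.inl hQ1.le⟩
        · rintro ⟨hc, -⟩
          exact mul_nonneg hm.le (sub_nonneg.2 hc)
      · have hc : Q ≤ cocoreCurve κ δ P := by
          rcases lt_or_ge P (3 * κ ^ 2 / 4) with h3 | h3
          · exact (lt_trans hQ2 (half_lt_cocoreCurve hκ hδ hP (by nlinarith))).le
          · rw [cocoreCurve_of_ge hκ h3]; linarith
        exact ⟨fun _ => ⟨hc, Or.inl hQ1.le⟩, fun _ => (modelHFun_pos_of hκ hδ hQ1 hQ2 hP hc).le⟩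

/-- **THE PUSHED HANDLE IS `{H ≥ 0} ∖ C`**:
`pushTarget κ δ = {‖x‖ ≤ 1, 0 ≤ H x} ∖ {x_μ = 0, ‖x_λ‖² = pFun κ 0}`. [folklore] -/
theorem pushTarget_eq (hκ : 0 < κ) (hκ2 : κ ≤ 1 / 2) (hδ : 0 < δ) (hδ2 : δ ≤ 1 / 2) :
    pushTarget κ δ = {x | ‖x‖ ≤ 1 ∧ 0 ≤ modelH κ δ x} \ {x | muPart x = 0 ∧ sOf x = pFun κ 0} := by
  ext x
  simp only [pushTarget, mem_sdiff, mem_setOf_eq, not_and]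
  constructor
  · rintro ⟨h1, h2, h3, h4⟩
    exact ⟨⟨h1, (modelH_nonneg_iff hκ hκ2 hδ hδ2 h1).2 ⟨h2, h3⟩⟩, fun h0 => (h4 h0).ne'⟩
  · rintro ⟨⟨h1, hH⟩, hC⟩
    obtain ⟨h2, h3⟩ := (modelH_nonneg_iff hκ hκ2 hδ hδ2 h1).1 hH
    refine ⟨h1, h2, h3, fun h0 => lt_of_le_of_ne ?_ (Ne.symm (hC h0))⟩
    -- at `x_μ = 0`: `H = P - pFun κ 0 ≥ 0`
    have hQ : muN x = 0 := (muPart_eq_zero_iff x).1 h0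
    have := hH
    rw [modelH_eq, hQ, modelHFun_of_le hδ (by linarith), zero_div, sub_nonneg] at this
    exact this

/-- **THE SEAM GOES INTO THE OPEN BALL ONTO `{H = 0}`**: for `‖x‖ = 1`, `0 < ‖x_λ‖² < 3κ²/4`,
`H (sh x) = 0` and `‖sh x‖ < 1`. [folklore] -/
theorem modelH_modelPush_seam (hκ : 0 < κ) (hκ2 : κ ≤ 1 / 2) (hδ : 0 < δ) (hδ2 : δ ≤ 1 / 2)
    {x : EuclideanSpace ℝ (Fin 4)} (hx : lamPart x ≠ 0) (h1 : ‖x‖ = 1) (h2 : sOf x < 3 * κ ^ 2 / 4) :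
    modelH κ δ (modelPush κ δ x) = 0 ∧ ‖modelPush κ δ x‖ < 1 := by
  have hκsq : κ ^ 2 ≤ 1 / 4 := by nlinarith
  have hseam := modelPush_seam hκ hκ2 hδ hδ2 hx h1 h2
  set P' := sOf (modelPush κ δ x) with hP'd
  set Q' := muN (modelPush κ δ x) with hQ'd
  have hnorm : P' + Q' < 1 → ‖modelPush κ δ x‖ < 1 := fun h => by
    have h' : ‖modelPush κ δ x‖ ^ 2 < 1 := by rw [norm_sq_eq_lamPart_muPart]; exact h
    nlinarith [norm_nonneg (modelPush κ δ x)]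
  have hP'lt : P' < 3 * κ ^ 2 / 4 := by
    rw [hP'd, sOf_modelPush hκ hx]
    rcases lt_or_ge (sOf x) (κ ^ 2 / 2) with h | h
    · linarith [(pushP_mem hκ h (q := muScaleSq κ δ (sOf x) * muN x / δ)).2, pow_pos hκ 2]
    · rwa [pushP_of_ge _ h]
  rw [modelH_eq, ← hP'd, ← hQ'd]
  rcases hseam with ⟨hQ4, hQc⟩ | ⟨hQ4, hPp⟩
  · -- on the ridge `Q' = ϱ(P')`, `Q' ≥ δ/4`: strictly inside the ball since `ω(P'/κ²) < 1`
    have hQ'lt : Q' < 1 - P' := by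
      have hlt : P' / κ ^ 2 < 3 / 4 := by rw [div_lt_iff₀ (by positivity)]; linarith
      have hω : shellCut (P' / κ ^ 2) < 1 := Real.smoothTransition.lt_one_of_lt_one (by linarith)
      have hlin : δ * P' / κ ^ 2 < 1 - P' := by
        rw [div_lt_iff₀ (by positivity)]; nlinarith
      rw [hQc, ridge]
      nlinarith [mul_pos (sub_pos.2 hω) (sub_pos.2 hlin)]
    refine ⟨?_, hnorm (by linarith)⟩
    rcases le_or_gt (δ / 2) Q' with hQ2 | hQ2
    · rw [modelHFun_of_ge hδ hQ2, ← ridge_eq_cocoreCurve, ← hQc, sub_self]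
    · rcases le_or_gt P' (κ ^ 2 / 2) with hP | hP
      · rw [modelHFun_line hκ hδ hQ4 hP, ← ridge_of_le hκ hP, ← hQc, sub_self, mul_zero]
      · have := half_lt_cocoreCurve hκ hδ hP (by nlinarith)
        rw [← ridge_eq_cocoreCurve, ← hQc] at this
        linarith
  · -- on the swap-slab boundary `P' = pFun κ (Q'/δ)`, `Q' < δ/4`
    refine ⟨by rw [modelHFun_of_le hδ hQ4.le, hPp, sub_self], hnorm ?_⟩
    have : pFun κ (Q' / δ) ≤ κ ^ 2 * (Q' / δ + 1 / 8) := PushModel.pFun_le _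
    have hq : Q' / δ < 1 / 4 := by rw [div_lt_iff₀ hδ]; linarith
    nlinarith [pow_pos hκ 2]

end Region

end PushModel

/-- **Registered helper `helper_pushModel_modelH` (brick (PUSH-f) of T3b (ii), sub-goal of NF6
`stub_steinRealisation`, wave 3, lead c5): in terms of Z2's model function `H = modelH κ δ` of the
cocore neighbourhood, the model push `modelPush κ δ` maps the punctured handle `{x_λ ≠ 0, ‖x‖ ≤ 1}`
(= `X₁ ∖ γ` in the handle chart) ONTO `{‖x‖ ≤ 1, 0 ≤ H x}` minus the circle
`{x_μ = 0, ‖x_λ‖² = pFun κ 0}` (the blow-down of `γ`), and the seam `{‖x‖ = 1, ‖x_λ‖² < 3κ²/4}`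
into the open ball onto `{H = 0}`.** [folklore] -/
theorem helper_pushModel_modelH : ∀ {κ δ : ℝ}, 0 < κ → κ ≤ 1 / 2 → 0 < δ → δ ≤ 1 / 2 → Summit.SmoothPoincare4.SmoothPoincare4.Theorems.AcyclicBisectionExists.ModpBraidOrbits.PushModel.modelPush κ δ '' {x : EuclideanSpace ℝ (Fin 4) | Literature.Topology.FourManifolds.lamPart x ≠ 0 ∧ ‖x‖ ≤ 1} = {x : EuclideanSpace ℝ (Fin 4) | ‖x‖ ≤ 1 ∧ 0 ≤ Summit.SmoothPoincare4.SmoothPoincare4.Theorems.AcyclicBisectionExists.ModpBraidOrbits.modelH κ δ x} \ {x : EuclideanSpace ℝ (Fin 4) | Literature.Topology.FourManifolds.muPart x = 0 ∧ ‖Literature.Topology.FourManifolds.lamPart x‖ ^ 2 = Summit.SmoothPoincare4.SmoothPoincare4.Theorems.AcyclicBisectionExists.ModpBraidOrbits.pFun κ 0} ∧ (∀ x : EuclideanSpace ℝ (Fin 4), Literature.Topology.FourManifolds.lamPart x ≠ 0 → ‖x‖ = 1 → ‖Literature.Topology.FourManifolds.lamPart x‖ ^ 2 < 3 * κ ^ 2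 / 4 → Summit.SmoothPoincare4.SmoothPoincare4.Theorems.AcyclicBisectionExists.ModpBraidOrbits.modelH κ δ (Summit.SmoothPoincare4.SmoothPoincare4.Theorems.AcyclicBisectionExists.ModpBraidOrbits.PushModel.modelPush κ δ x) = 0 ∧ ‖Summit.SmoothPoincare4.SmoothPoincare4.Theorems.AcyclicBisectionExists.ModpBraidOrbits.PushModel.modelPush κ δ x‖ < 1) := by
  intro κ δ hκ hκ2 hδ hδ2
  refine ⟨?_, fun x hx h1 h2 => PushModel.modelH_modelPush_seam hκ hκ2 hδ hδ2 hx h1 h2⟩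
  rw [PushModel.image_modelPush_ball hκ hκ2 hδ hδ2, PushModel.pushTarget_eq hκ hκ2 hδ hδ2]
  rfl

end Summit.SmoothPoincare4.SmoothPoincare4.Theorems.AcyclicBisectionExists.ModpBraidOrbits

end
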